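import Mathlib.GroupTheory.GroupAction.ConjAct
import Literature.AnabelianGeometry.EtaleTheta.TemperedFrobenioidToyTorsion
import Literature.AnabelianGeometry.EtaleTheta.Discharge.Sec5CyclotomicCompatXRatFnNV
import Literature.AlgebraicGeometry.Frobenioids.ModelFrobenioidAmpleness
import Literature.AlgebraicGeometry.Frobenioids.DegreeModelFrobenioid

/-!
# [EtTh] Lemma 5.8 proof p. 331 (PDF p. 105): a POSITIVE, NON-DEGENERATE instance of the F-1306 rational-function
# clause (c1′) — the [FrdI] Thm. 5.2 (i) model Frobenioid of abc-iut-L2-t3's torsion data `ToyTorsion` (model file)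

Mochizuki, *The étale theta function …*, Publ. RIMS **45** (2009) [cite: MochizukiEtTh2009, Lem 5.8 proof p.331 (PDF p.105);
Def 3.3 (iii) p.299 (PDF p.73)]; Mochizuki, *The geometry of Frobenioids I*, Kyushu J. Math. **62** (2008), Thm. 5.2 (i) p. 100
[cite: MochizukiFrdI2008, Thm. 5.2 (i) p.100]; [FrdII] Thm. 1.2 (i) p. 9 (the lifts `(1, g, 0, 1)`).
abc-iut cell, layer L2; row R228-NEXT of abc-iut-L2-lead (gen 4) «(c1′) AT A CONCRETE FROBENIOID», part 2/2; seat abc-iut-f-125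
(gen 3).  CLASS (b) MODEL FILE (new path; constructions + theorems; nothing landed is edited or restated).

WHY.  Part 1 (`Discharge/Sec5CyclotomicCompatXRatFnNV.lean`, p442935) showed: (c1′) ⟺ «`χ'` is the base-conjugation character of
a section of `ρ`» in general; «`χ'` trivial» over a one-object base WITHOUT automorphisms; and TRUE-but-only-vacuously-instantiable
(`μ_N = 1`) at the tree's two constructed tempered Frobenioids.  The L2 census (abc-iut-L2-t3 (c1′), abc-iut-L2-lead R228,
10:41Z) had NO positive instance of the SHARP form ON THE RATIONAL-FUNCTION SIDE — non-trivial torsion constants of `B` MOVED by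
the Galois action of the base, as in print ("`Π^tp_Y` [i.e., `G_K` …] acts … via multiplication by an element of `μ_N(B_N)`");
abc-iut-f-116's `Sec5ToyNineFacts` (p443674) meanwhile witnesses F-1306 ITSELF at the free §5 toy `toy₉` (no `tf`), which is
complementary: (c1′) is the form F-1306 takes on the data that DEFINE a tempered Frobenioid.  abc-iut-L2-t3's `ToyTorsion`
(TemperedFrobenioidToyTorsion.lean, p437160) is exactly such a Def. 3.3 (iii) datum: base `D₀ = SingleObj ℤ` (ONE object `⋆`,
`Aut(⋆) = ℤ`), `Φ₀ = ℕ` (trivial action), `B₀ = ℤ × (ℤ/2)²` with the generator `γ` SWAPPING the two `ℤ/2`-factors, `div₀ = pr₁`.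

WHAT.  §0 `DivisorMonoids.divNatTrans` — the natural transformation `B₀ → Φ₀^gp` of ANY Def. 3.3 (iii) datum (its field
`div₀` + `div₀_natural`), so that `ModelFrobenioid dm.Φ₀ dm.B₀ dm.divNatTrans` is the [FrdI] Thm. 5.2 (i) model Frobenioid of the
datum (`Λ = ℤ`: `B = B₀^ℤ = B₀`, `Φ := Φ₀`; NOT routed through Def. 3.6 (ii)'s realification — honest label).  §1 at `ToyTorsion`:
the Frobenius-trivial object `X = (⋆, 0)`; the regular Galois action `ρ : ℤ → Aut_{D₀}(⋆)`; its SECTION `e : ℤ → Aut_C(X)`,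
`n ↦ (1, n, 0, 1)` ([FrdII] Thm. 1.2 (i) lifts; `Base ∘ e = ρ`); the torsion units `u_v = (1, id, 0, (0, v)) ∈ μ_2(X)`, `v ∈ (ℤ/2)²`
([FrdI] Thm. 5.2 (ii), abc-iut-L1's `unitAut`); the base-conjugation character `χ_e := conj ∘ e : ℤ → Aut(μ_2(X))`.
§2 TRUTH VALUES (with the identity reading `m := id` of `μ_2(X)`):
* `ratFnClause_conjChar` — **(c1′) HOLDS for `χ' := χ_e`** (part 1's `ratFnClause_of_section_of_forall_eq_conj`);
* `conjChar_ne_one`, `torsionUnit_ne_one` — **NON-DEGENERATE**: `μ_2(X) ≠ 1` and `χ_e(γ)` MOVES `u_{(1,0)}` to `u_{(0,1)}` (the swap: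
  conjugation pulls the rational function back along `Base(e(γ)⁻¹) = γ⁻¹`, [FrdI] Thm. 5.2 (i));
* `not_ratFnClause_one` — **(c1′) FAILS for the trivial character** at the same datum;
* `ratFnClause_iff_eq_conjChar` — for EVERY `χ' : ℤ → Aut(μ_2(X))`: (c1′) ⟺ `χ' = χ_e`.
So F-1306's sharp form IS instantiable at a constructed model Frobenioid, and the clause pins `χ'` to the Galois action on the
torsion constants — a consistency witness for the census line (c1′), nothing more.
HONEST LABEL: genuine [FrdI] Thm. 5.2 (i) category over L2-t3's Def. 3.3 (iii) toy datum; DEGENERATE geometry (one base object,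
`Φ₀ = ℕ`, all functions constant, `μ_2 = (ℤ/2)²` not cyclic); NOT the tempered Frobenioid of a curve, NOT Def. 3.6 (ii)'s `C`
(no realification); a FACT row is an assumption label; no side is taken on [IUTchIII] Cor. 3.12; typed ≠ proved.
-/

noncomputable section

namespace Literature.AnabelianGeometry.EtaleTheta

open CategoryTheory Opposite Literature.AlgebraicGeometry.Frobenioids

universe u₀ v₀ w

/-! ### §0 The [FrdI] Thm. 5.2 (i) model Frobenioid of a Def. 3.3 (iii) datum (`Λ = ℤ`, no realification) -/

namespace DivisorMonoids

variable {D₀ : Type u₀} [Category.{v₀} D₀] (dm : DivisorMonoids.{u₀, v₀, w} D₀)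

/-- **`B₀ → Φ₀^gp` as a natural transformation** ("a natural transformation `B₀ → Φ₀^gp` [given by assigning to a
log-meromorphic function its log-divisor of zeroes and poles]", Def. 3.3 (iii)): the fields `div₀`, `div₀_natural` of the datum
packaged as the arrow `Div_B : B → Φ^gp` that [FrdI] Thm. 5.2 (i) consumes.  [cite: MochizukiEtTh2009, Def 3.3 p.299 (PDF p.73)] -/
def divNatTrans : dm.B₀ ⟶ monoidGp dm.Φ₀ where
  app Y := CommMonCat.ofHom (dm.div₀ Y)
  naturality {Y Y'} f := by
    apply CommMonCat.hom_ext
    ext b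
    change dm.div₀ Y' ((dm.B₀.map f).hom b) = MonGp.map (dm.Φ₀.map f).hom (dm.div₀ Y b)
    rw [dm.div₀_natural]
    rfl

/-- `Div_B` at `Y` is `div₀`. [cite: MochizukiEtTh2009, Def 3.3 p.299 (PDF p.73)] -/
@[simp] theorem divB_divNatTrans (Y : D₀ᵒᵖ) (b : dm.B₀.obj Y) : divB dm.Φ₀ dm.B₀ dm.divNatTrans Y b = dm.div₀ Y b := rfl

end DivisorMonoids

/-! ### §1 The model Frobenioid of `ToyTorsion`: the object `(⋆, 0)`, the Galois action, its section, the torsion units -/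

namespace ToyTorsion

/-- The [FrdI] Thm. 5.2 (i) model Frobenioid `C` of the torsion datum: objects `(⋆, α)`, `α ∈ Φ₀(⋆)^gp = ℤ`; morphisms
`(deg_Fr, n ∈ ℤ = End(⋆), Div ∈ ℕ, u ∈ ℤ × (ℤ/2)²)`.  [cite: MochizukiFrdI2008, Thm. 5.2 (i) p.100] -/
abbrev Model : Type := ModelFrobenioid divisorMonoids.Φ₀ divisorMonoids.B₀ divisorMonoids.divNatTrans

/-- The Frobenius-trivial object `X := (⋆, 0)` ([FrdI] Thm. 5.2 proof p.101: "the objects `(A_D, α)` such that `α = 0` are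
Frobenius-trivial").  [cite: MochizukiFrdI2008, Thm. 5.2 p.101] -/
def X₀ : Model := ⟨SingleObj.star (Multiplicative ℤ), 1⟩

/-- `Φ₀ = ℕ` of the torsion datum is divisorial (abc-iut-L1's `isDivisorial_N`). [cite: MochizukiFrdI2008, Def. 1.1 (i) p.19] -/
theorem objectwise_isDivisorial_Φ₀ : Objectwise (fun M _ => IsDivisorial M) divisorMonoids.Φ₀ := fun _ => DegreeModel.isDivisorial_N

/-- `End(⋆) = ℤ` acts trivially on `Φ₀ = ℕ` (constant functor). [cite: MochizukiEtTh2009, Def 3.3 p.299 (PDF p.73)] -/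
theorem Φ₀_map_eq_id ⦃A : Base⦄ (g : A ⟶ A) : divisorMonoids.Φ₀.map g.op = 𝟙 _ := rfl

/-- **The regular Galois action `ρ : ℤ → Aut_{D₀}(⋆)`**, `n ↦ (⋆ —n→ ⋆)` (the automorphism group of the one object IS `ℤ`).
[cite: MochizukiEtTh2009, Def 3.3 p.299 (PDF p.73)] -/
def rho : Multiplicative ℤ →* Aut X₀.base where
  toFun n := ⟨n, n⁻¹, inv_mul_cancel n, mul_inv_cancel n⟩
  map_one' := Iso.ext rfl
  map_mul' _ _ := Iso.ext rfl

/-- `ρ(n)` is the arrow `n`. [cite: MochizukiEtTh2009, Def 3.3 p.299 (PDF p.73)] -/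
@[simp] theorem rho_hom (n : Multiplicative ℤ) : (rho n).hom = n := rfl

/-- `ρ(n)⁻¹` is the arrow `n⁻¹`. [cite: MochizukiEtTh2009, Def 3.3 p.299 (PDF p.73)] -/
@[simp] theorem rho_inv (n : Multiplicative ℤ) : (rho n).inv = n⁻¹ := rfl

/-- The lift `(1, n, 0, 1) ∈ Aut_C(X)` of `n ∈ Aut_{D₀}(⋆)` ([FrdII] Thm. 1.2 (i): "`End_D(A_D)` acts trivially on `Φ(A_D)` …
`C` is of `Aut`-ample type"; abc-iut-L1's `rel_of_endTrivial`).  [cite: MochizukiFrdI2008, Thm. 5.2 p.101] -/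
def lift (n : Multiplicative ℤ) : Aut X₀ where
  hom := ⟨1, (rho n).hom, 1, 1, ModelFrobenioid.rel_of_endTrivial Φ₀_map_eq_id X₀.cls _⟩
  inv := ⟨1, (rho n).inv, 1, 1, ModelFrobenioid.rel_of_endTrivial Φ₀_map_eq_id X₀.cls _⟩
  hom_inv_id := by
    apply ModelFrobenioid.hom_ext
    · exact mul_one _
    · exact (rho n).hom_inv_id
    · change (divisorMonoids.Φ₀.map (rho n).hom.op).hom 1 * 1 ^ ((1 : ℕ+) : ℕ) = 1
      rw [map_one, one_pow, mul_one]
    · change (divisorMonoids.B₀.map (rho n).hom.op).hom 1 * 1 ^ ((1 : ℕ+) : ℕ) = 1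
      rw [map_one, one_pow, mul_one]
  inv_hom_id := by
    apply ModelFrobenioid.hom_ext
    · exact mul_one _
    · exact (rho n).inv_hom_id
    · change (divisorMonoids.Φ₀.map (rho n).inv.op).hom 1 * 1 ^ ((1 : ℕ+) : ℕ) = 1
      rw [map_one, one_pow, mul_one]
    · change (divisorMonoids.B₀.map (rho n).inv.op).hom 1 * 1 ^ ((1 : ℕ+) : ℕ) = 1
      rw [map_one, one_pow, mul_one]

/-- **The section `e : ℤ → Aut_C(X)` of `ρ`**, `n ↦ (1, n, 0, 1)` — a homomorphism (print's base-sections `s^trv_N`, `s^⊓-gp_N`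
are of this kind, [FrdI] Prop. 5.6).  [cite: MochizukiFrdI2008, Thm. 5.2 p.101] -/
def sect : Multiplicative ℤ →* Aut X₀ where
  toFun := lift
  map_one' := Iso.ext (ModelFrobenioid.hom_ext rfl rfl rfl rfl)
  map_mul' a b := by
    apply Iso.ext
    apply ModelFrobenioid.hom_ext
    · exact (mul_one _).symm
    · rfl
    · change (1 : divisorMonoids.Φ₀.obj (op X₀.base)) =
        (divisorMonoids.Φ₀.map (rho b).hom.op).hom 1 * 1 ^ ((1 : ℕ+) : ℕ)
      rw [map_one, one_pow, mul_one]
    · change (1 : divisorMonoids.B₀.obj (op X₀.base)) =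
        (divisorMonoids.B₀.map (rho b).hom.op).hom 1 * 1 ^ ((1 : ℕ+) : ℕ)
      rw [map_one, one_pow, mul_one]

/-- `Base(e(n)) = ρ(n)`: `e` IS a section of `ρ`. [cite: MochizukiFrdI2008, Thm. 5.2 p.101] -/
theorem baseMap_sect (n : Multiplicative ℤ) : ModelFrobenioid.baseMap (sect n).hom = (rho n).hom := rfl

/-- `O^×(X)` is commutative ([FrdI] Rmk. 1.3.1; abc-iut-L1's `isMulCommutative_units`), in the form `nTorsionIn` consumes.
[cite: MochizukiFrdI2008, Thm. 5.2 (ii) p.101] -/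
theorem units_comm : ∀ x ∈ (PreFrobenioidData.ofModel divisorMonoids.Φ₀ divisorMonoids.B₀ divisorMonoids.divNatTrans).unitsSubgroup X₀,
    ∀ y ∈ (PreFrobenioidData.ofModel divisorMonoids.Φ₀ divisorMonoids.B₀ divisorMonoids.divNatTrans).unitsSubgroup X₀,
      x * y = y * x :=
  fun x hx y hy => congrArg Subtype.val
    ((ModelFrobenioid.isMulCommutative_units X₀).is_comm.comm (⟨x, hx⟩ : ModelFrobenioid.units X₀) ⟨y, hy⟩)

/-- `μ_2(X) ⊆ Aut_C(X)`, the `2`-torsion of `O^×(X)` ([FrdII] Def. 2.1 (i); the tree's `nTorsionIn`).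
[cite: MochizukiEtTh2009, Def 5.4 p.327 (PDF p.101)] -/
abbrev muTwo : Subgroup (Aut X₀) :=
  nTorsionIn ((PreFrobenioidData.ofModel divisorMonoids.Φ₀ divisorMonoids.B₀ divisorMonoids.divNatTrans).unitsSubgroup X₀)
    units_comm 2

/-- Every element of `(ℤ/2)²` (multiplicatively) squares to `1`. [folklore] -/
private theorem mul_self_V (v : V) : v * v = 1 := by
  have h : ∀ x : Multiplicative (ZMod 2), x * x = 1 := fun x => by
    apply Multiplicative.toAdd.injective
    rw [toAdd_mul, toAdd_one]
    exact (by decide : ∀ y : ZMod 2, y + y = 0) _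
  exact Prod.ext (h v.1) (h v.2)

/-- `Div_B((0, v)) = 0`: the elements `(0, v) ∈ B₀ = ℤ × (ℤ/2)²` have trivial divisor (`div₀ = pr₁`).
[cite: MochizukiEtTh2009, Def 3.3 p.299 (PDF p.73)] -/
theorem of_one_eq_divB (v : V) :
    Algebra.GrothendieckGroup.of (1 : divisorMonoids.Φ₀.obj (op X₀.base)) =
      divB divisorMonoids.Φ₀ divisorMonoids.B₀ divisorMonoids.divNatTrans (op X₀.base) ((1 : Multiplicative ℤ), v) := by
  rw [map_one, DivisorMonoids.divB_divNatTrans]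
  exact (map_one Toy.divHom).symm

/-- **The torsion unit `u_v := (1, id, 0, (0, v)) ∈ Aut_C(X)`** for `v ∈ (ℤ/2)²` ([FrdI] Thm. 5.2 (ii): `O^×(A) ≅ Ker(B → Φ^gp)`;
abc-iut-L1's `unitAut`).  [cite: MochizukiFrdI2008, Thm. 5.2 (ii) p.101] -/
def torsionUnit (v : V) : Aut X₀ :=
  ModelFrobenioid.unitAut X₀ 1 1 ((1 : Multiplicative ℤ), v) ((1 : Multiplicative ℤ), v⁻¹) (of_one_eq_divB v)
    (of_one_eq_divB v⁻¹) (mul_one _) (Prod.ext (mul_one _) (inv_mul_cancel v))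

/-- The rational function of `u_v` is `(0, v)`. [cite: MochizukiFrdI2008, Thm. 5.2 (i) p.100] -/
@[simp] theorem unit_torsionUnit (v : V) : ModelFrobenioid.unit (torsionUnit v).hom = ((1 : Multiplicative ℤ), v) := rfl

/-- `u_v ∈ O^×(X)`. [cite: MochizukiFrdI2008, Thm. 5.2 (ii) p.101] -/
theorem torsionUnit_mem_units (v : V) :
    torsionUnit v ∈ (PreFrobenioidData.ofModel divisorMonoids.Φ₀ divisorMonoids.B₀ divisorMonoids.divNatTrans).unitsSubgroup X₀ :=
  ⟨rfl, rfl⟩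

/-- A unit of `X` is determined by its rational function ([FrdI] Thm. 5.2 (i), `Φ₀` divisorial).
[cite: MochizukiFrdI2008, Thm. 5.2 (i) p.100] -/
theorem eq_of_unit_eq {u u' : Aut X₀}
    (hu : u ∈ (PreFrobenioidData.ofModel divisorMonoids.Φ₀ divisorMonoids.B₀ divisorMonoids.divNatTrans).unitsSubgroup X₀)
    (hu' : u' ∈ (PreFrobenioidData.ofModel divisorMonoids.Φ₀ divisorMonoids.B₀ divisorMonoids.divNatTrans).unitsSubgroup X₀)
    (h : ModelFrobenioid.unit u.hom = ModelFrobenioid.unit u'.hom) : u = u' :=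
  ModelFrobenioid.aut_eq_of_baseMap_eq_of_unit_eq objectwise_isDivisorial_Φ₀ (hu.1.trans hu'.1.symm) h

/-- The rational function of a product of units is the product ([FrdI] Thm. 5.2 (i) composition law, `Base = id`, `deg_Fr = 1`).
[cite: MochizukiFrdI2008, Thm. 5.2 (i) p.100] -/
theorem unit_mul_of_mem_units {u u' : Aut X₀}
    (hu : u ∈ (PreFrobenioidData.ofModel divisorMonoids.Φ₀ divisorMonoids.B₀ divisorMonoids.divNatTrans).unitsSubgroup X₀)
    (hu' : u' ∈ (PreFrobenioidData.ofModel divisorMonoids.Φ₀ divisorMonoids.B₀ divisorMonoids.divNatTrans).unitsSubgroup X₀) :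
    ModelFrobenioid.unit (u * u').hom = ModelFrobenioid.unit u.hom * ModelFrobenioid.unit u'.hom := by
  have hb : ModelFrobenioid.baseMap u'.hom = 𝟙 X₀.base := hu'.1
  have hd : ModelFrobenioid.degFr u.hom = 1 := hu.2
  change ModelFrobenioid.unit (u'.hom ≫ u.hom) = _
  rw [ModelFrobenioid.unit_comp, hb, hd, ModelFrobenioid.map_id_apply_B, PNat.one_coe, pow_one]

/-- `u_v² = 1`: `u_v ∈ μ_2(X)`. [cite: MochizukiEtTh2009, Def 5.4 p.327 (PDF p.101)] -/
theorem torsionUnit_mem_muTwo (v : V) : torsionUnit v ∈ muTwo := by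
  refine ⟨torsionUnit_mem_units v, ?_⟩
  rw [pow_two]
  refine eq_of_unit_eq (Subgroup.mul_mem _ (torsionUnit_mem_units v) (torsionUnit_mem_units v)) (Subgroup.one_mem _) ?_
  rw [unit_mul_of_mem_units (torsionUnit_mem_units v) (torsionUnit_mem_units v), unit_torsionUnit]
  exact Prod.ext (mul_one _) (mul_self_V v)

/-- `u_v ≠ 1` for `v ≠ 0`: **`μ_2(X)` is NOT trivial.** [cite: MochizukiEtTh2009, Def 5.4 p.327 (PDF p.101)] -/
theorem torsionUnit_ne_one {v : V} (hv : v ≠ 1) : torsionUnit v ≠ 1 := fun h => by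
  have h2 := congrArg (fun u : Aut X₀ => (ModelFrobenioid.unit u.hom).2) h
  change (((1 : Multiplicative ℤ), v) : M).2 = (ModelFrobenioid.unit (𝟙 X₀)).2 at h2
  rw [ModelFrobenioid.unit_id] at h2
  exact hv h2

/-- `O^×(X)` is normal in `Aut_C(X)` (`Base`, `deg_Fr` are multiplicative). [cite: MochizukiFrdI2008, Thm. 5.2 (ii) p.101] -/
theorem unitsSubgroup_normal :
    ((PreFrobenioidData.ofModel divisorMonoids.Φ₀ divisorMonoids.B₀ divisorMonoids.divNatTrans).unitsSubgroup X₀).Normal :=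
  ⟨fun u hu e => ⟨ModelFrobenioid.baseMap_conj' e (f := u.hom) hu.1, ModelFrobenioid.degFr_conj' e (f := u.hom) hu.2⟩⟩

/-- `μ_2(X)` is normal in `Aut_C(X)`. [cite: MochizukiEtTh2009, §5 p.331 (PDF p.105)] -/
theorem muTwo_normal : muTwo.Normal :=
  haveI := unitsSubgroup_normal
  nTorsionIn_normal _ units_comm 2

/-- **The base-conjugation character `χ_e := conj ∘ e : ℤ → Aut(μ_2(X))`**, `n ↦ (u ↦ e(n) u e(n)⁻¹)` — "the Galois action on the
torsion constants" of this model (print: "`Π^tp_Y` … acts … via multiplication by an element of `μ_N(B_N)`").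
[cite: MochizukiEtTh2009, Lem 5.8 proof p.331 (PDF p.105)] -/
def conjChar : Multiplicative ℤ →* MulAut muTwo :=
  haveI := muTwo_normal
  MulAut.conjNormal.comp sect

/-- `χ_e(n)(u) = e(n) u e(n)⁻¹`. [cite: MochizukiEtTh2009, Lem 5.8 proof p.331 (PDF p.105)] -/
theorem conjChar_apply_coe (n : Multiplicative ℤ) (u : muTwo) : ((conjChar n u : muTwo) : Aut X₀) = sect n * u.1 * (sect n)⁻¹ :=
  haveI := muTwo_normal
  MulAut.conjNormal_apply (sect n) u

/-! ### §2 Truth values of (c1′) at `(X, ρ, N = 2, M = μ_2(X), m = id)` -/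

/-- **(c1′) HOLDS at the torsion model for `χ' := χ_e`** (part 1's `ratFnClause_of_section_of_forall_eq_conj`).
[cite: MochizukiEtTh2009, Lem 5.8 proof p.331 (PDF p.105)] [cite: MochizukiFrdI2008, Thm. 5.2 (i) p.100] -/
theorem ratFnClause_conjChar :
    ∀ (g : Multiplicative ℤ) (u u' : muTwo),
      ModelFrobenioid.unit u'.1.hom = pull divisorMonoids.B₀ (rho g).inv (ModelFrobenioid.unit u.1.hom) →
        (MulEquiv.refl muTwo) u' = conjChar g ((MulEquiv.refl muTwo) u) :=
  ratFnClause_of_section_of_forall_eq_conj X₀ units_comm rho 2 (MulEquiv.refl muTwo) conjChar objectwise_isDivisorial_Φ₀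
    sect baseMap_sect fun g u => Subtype.ext (conjChar_apply_coe g u)

/-- **For EVERY character `χ' : ℤ → Aut(μ_2(X))`: (c1′) at the torsion model ⟺ `χ' = χ_e`** — the clause pins the character to
the Galois action on the torsion constants (part 1's `ratFnClause_iff_forall_chi_apply_eq_conj_of_section`).
[cite: MochizukiEtTh2009, Lem 5.8 proof p.331 (PDF p.105)] [cite: MochizukiFrdI2008, Thm. 5.2 (i) p.100] -/
theorem ratFnClause_iff_eq_conjChar (χ' : Multiplicative ℤ →* MulAut muTwo) :
    (∀ (g : Multiplicative ℤ) (u u' : muTwo),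
      ModelFrobenioid.unit u'.1.hom = pull divisorMonoids.B₀ (rho g).inv (ModelFrobenioid.unit u.1.hom) →
        (MulEquiv.refl muTwo) u' = χ' g ((MulEquiv.refl muTwo) u)) ↔ χ' = conjChar := by
  rw [ratFnClause_iff_forall_chi_apply_eq_conj_of_section X₀ units_comm rho 2 (MulEquiv.refl muTwo) χ'
    objectwise_isDivisorial_Φ₀ sect baseMap_sect]
  constructor
  · intro h
    exact MonoidHom.ext fun g => MulEquiv.ext fun u => (h g u).trans (Subtype.ext (conjChar_apply_coe g u)).symm
  · rintro rfl g u
    exact Subtype.ext (conjChar_apply_coe g u)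

/-- **Reading-independent form**: for EVERY cyclotome reading `m : μ_2(X) ≃ M` and EVERY `χ' : ℤ → Aut(M)`, (c1′) at the
torsion model ⟺ `χ'(g) = m ∘ χ_e(g) ∘ m⁻¹` for all `g` — the clause pins `χ'` to the transported Galois action.
[cite: MochizukiEtTh2009, Lem 5.8 proof p.331 (PDF p.105)] [cite: MochizukiFrdI2008, Thm. 5.2 (i) p.100] -/
theorem ratFnClause_iff_eq_conjChar_conj {M : Type w} [Group M] (m : muTwo ≃* M) (χ' : Multiplicative ℤ →* MulAut M) :
    (∀ (g : Multiplicative ℤ) (u u' : muTwo),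
      ModelFrobenioid.unit u'.1.hom = pull divisorMonoids.B₀ (rho g).inv (ModelFrobenioid.unit u.1.hom) → m u' = χ' g (m u)) ↔
      ∀ g : Multiplicative ℤ, χ' g = (m.symm.trans (conjChar g)).trans m := by
  rw [ratFnClause_iff_forall_chi_apply_eq_conj_of_section X₀ units_comm rho 2 m χ' objectwise_isDivisorial_Φ₀ sect baseMap_sect]
  constructor
  · intro h g
    refine MulEquiv.ext fun x => ?_
    have hx := h g (m.symm x)
    rw [MulEquiv.apply_symm_apply] at hx
    rw [hx, MulEquiv.trans_apply, MulEquiv.trans_apply]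
    exact (congrArg m (Subtype.ext (conjChar_apply_coe g (m.symm x)))).symm
  · intro h g u
    rw [h g, MulEquiv.trans_apply, MulEquiv.trans_apply, MulEquiv.symm_apply_apply]
    exact congrArg m (Subtype.ext (conjChar_apply_coe g u))

/-- The generator `γ = 1 ∈ ℤ`, multiplicatively. [cite: MochizukiEtTh2009, Def 3.3 p.299 (PDF p.73)] -/
abbrev gen : Multiplicative ℤ := Multiplicative.ofAdd 1

/-- Pull-back along `γ⁻¹` on `B₀ = ℤ × (ℤ/2)²` is the swap `swapE` (the action is by the involution `swapE`).
[cite: MochizukiEtTh2009, Def 3.3 p.299 (PDF p.73)] -/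
theorem pull_rho_gen_inv (x : M) : pull divisorMonoids.B₀ (rho gen).inv x = swapE x := by
  change (act (Multiplicative.ofAdd (1 : ℤ))⁻¹) x = swapE x
  rw [map_inv, act_apply, toAdd_ofAdd, zpow_one, MulAut.inv_apply, MulEquiv.symm_apply_eq]
  rfl

/-- **`χ_e(γ)` swaps: `e(γ) u_{(a,b)} e(γ)⁻¹ = u_{(b,a)}`** — conjugation pulls the rational function back along `Base(e(γ)⁻¹) = γ⁻¹`
([FrdI] Thm. 5.2 (i)), i.e. applies the swap.  [cite: MochizukiFrdI2008, Thm. 5.2 (i) p.100] -/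
theorem sect_gen_conj_torsionUnit (v : V) :
    sect gen * torsionUnit v * (sect gen)⁻¹ = torsionUnit (v.2, v.1) := by
  have hmem := conj_mem_nTorsionIn X₀ units_comm 2 (sect gen) ⟨torsionUnit v, torsionUnit_mem_muTwo v⟩
  refine eq_of_unit_eq hmem.1 (torsionUnit_mem_units _) ?_
  rw [unit_conj_eq_pull_rho_of_baseMap_eq X₀ units_comm rho 2 gen (sect gen) (baseMap_sect gen)
    ⟨torsionUnit v, torsionUnit_mem_muTwo v⟩]
  change pull divisorMonoids.B₀ (rho gen).inv (ModelFrobenioid.unit (torsionUnit v).hom) = _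
  rw [unit_torsionUnit, pull_rho_gen_inv, swapE_apply, unit_torsionUnit]

/-- **`χ_e ≠ 1`: the Galois action MOVES a torsion constant** (`u_{(1,0)} ↦ u_{(0,1)} ≠ u_{(1,0)}`), so the instance of (c1′)
above is one of the SHARP form.  [cite: MochizukiEtTh2009, Lem 5.8 proof p.331 (PDF p.105)] -/
theorem conjChar_ne_one : conjChar ≠ 1 := by
  intro h
  have hb : (Multiplicative.ofAdd (1 : ZMod 2), (1 : Multiplicative (ZMod 2))) ≠
      ((1 : Multiplicative (ZMod 2)), Multiplicative.ofAdd (1 : ZMod 2)) := by decide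
  have key := conjChar_apply_coe gen ⟨torsionUnit (Multiplicative.ofAdd (1 : ZMod 2), 1), torsionUnit_mem_muTwo _⟩
  rw [h, MonoidHom.one_apply, MulAut.one_apply, sect_gen_conj_torsionUnit] at key
  have k2 := congrArg (fun u : Aut X₀ => (ModelFrobenioid.unit u.hom).2) key
  change (((1 : Multiplicative ℤ), (Multiplicative.ofAdd (1 : ZMod 2), (1 : Multiplicative (ZMod 2)))) : M).2 =
    (((1 : Multiplicative ℤ), ((1 : Multiplicative (ZMod 2)), Multiplicative.ofAdd (1 : ZMod 2))) : M).2 at k2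
  exact hb k2

/-- **(c1′) FAILS at the torsion model for the TRIVIAL character** (same `X, ρ, m`): the sharp Galois action is visible.
[cite: MochizukiEtTh2009, Lem 5.8 proof p.331 (PDF p.105)] -/
theorem not_ratFnClause_one :
    ¬ ∀ (g : Multiplicative ℤ) (u u' : muTwo),
      ModelFrobenioid.unit u'.1.hom = pull divisorMonoids.B₀ (rho g).inv (ModelFrobenioid.unit u.1.hom) →
        (MulEquiv.refl muTwo) u' = (1 : Multiplicative ℤ →* MulAut muTwo) g ((MulEquiv.refl muTwo) u) :=
  fun h => conjChar_ne_one ((ratFnClause_iff_eq_conjChar 1).mp h).symm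

/-- **`μ_2(X)` is non-trivial** (it contains `u_{(1,0)} ≠ 1`): the positive instance is not the degenerate `μ = 1` case of part 1.
[cite: MochizukiEtTh2009, Def 5.4 p.327 (PDF p.101)] -/
theorem muTwo_ne_bot : muTwo ≠ ⊥ := fun h =>
  torsionUnit_ne_one (v := (Multiplicative.ofAdd (1 : ZMod 2), 1)) (by decide)
    ((Subgroup.mem_bot).mp (h ▸ torsionUnit_mem_muTwo (Multiplicative.ofAdd (1 : ZMod 2), 1)))

end ToyTorsion

end Literature.AnabelianGeometry.EtaleTheta

end
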